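import Summits.AtomisticToContinuum.Crystallization.Theses.RepetitiveNetworkReduction

/-!
# `RepetitiveNetworkReduction.Assembly` — the assembly item BY NAME

The assembly item `Assembly` (`stmt-AtomisticToContinuum-27237`, rank 1) of route `RepetitiveNetworkReduction`
(sub-problem `Crystallization` of `AtomisticToContinuum`, a child node refining
`GrainCoreNetworkSplit.DenseNetworkLawGap`) is literally the curried type of the route's sorry-free deciding theorem
`Theses.RepetitiveNetworkReduction.closes`: recurrence transfer → periodic law gap → matrix-grain law gap →
collared-core law gap → repetitive-network law gap → `DenseNetworkLawGap`.  Nothing analytic happens here (pattern of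
`Theorems/GappedShellCensusAssembly.lean`); written by the decomp-a2c cell's lens-2 g18 seat. [folklore]
-/

namespace Summit.AtomisticToContinuum.Crystallization.Theorems.RepetitiveNetworkReductionAssembly

open Summit.AtomisticToContinuum.Crystallization.Theses.RepetitiveNetworkReduction

/-- **`RepetitiveNetworkReduction.Assembly` holds**: feed the five hypotheses, in order, to the route's deciding
theorem `Theses.RepetitiveNetworkReduction.closes`. [folklore] -/
theorem repetitiveNetworkReduction_assembly :
    Summit.AtomisticToContinuum.Crystallization.Theses.RepetitiveNetworkReduction.Assembly := by
  unfold Theses.RepetitiveNetworkReduction.Assembly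
  intro hRED hPer hG hC hREP
  exact closes hRED hPer hG hC hREP

end Summit.AtomisticToContinuum.Crystallization.Theorems.RepetitiveNetworkReductionAssembly
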